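import HarnessLib
import Summits.QuantumFields.YangMills.Theses.BalabanLadder
import Summits.QuantumFields.YangMills.Theorems.BalabanLadderUVSeamRecStubTransport
import Summits.QuantumFields.YangMills.Theorems.BalabanLadderUVSeamRecUnitTransfer
import Summits.QuantumFields.YangMills.Theorems.BalabanLadderUVSeamRecCeilingsResponseMomentsUnit
import Summits.QuantumFields.YangMills.Theorems.BalabanLadderUVSeamRecResponseMomentsRecentring
import Summits.QuantumFields.YangMills.Theorems.LangevinControlUVOSLegsFromFemtoAndGapStubAssemblyPlaneStrings
import Literature.MathematicalPhysics.QuantumLattice.RepLieAlgebraUnitary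
import Summits.QuantumFields.YangMills.Theorems.BalabanLadderUVSeamRecClassicalResponseDefs

/-! # LINE «classical-dominance» (the classical-response family, repaired at BOTH of its dead organs) for crux `UVSeamRec` (stmt-QuantumFields-20043) — ideator ym-idea-10 g3 (lens RESCUER), 2026-08-28

A RESCUED skeleton (crux workfile, not a registry write; the owner's pen decides; registry of record stays v5(α) `TemperedResponse`).

CORPSES AND LOCATED ORGANS.  The whole CLASSICAL-RESPONSE family of candidates for this crux — v6/v7c/v8c/v8d (LEAD), g0 `coldwall_pure`
(DR | cold-wall split | GD), g0 `guarded_classical_gap`, g2 `af_carrier` — shares one architecture, «quantum centre response ≤ coefficient × CLASSICAL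
centre response of the Dirichlet cube (+ rate), and the classical response is typical under the torus state», and died or was priced at TWO organs:
* K2 — a POSITED reference value `p` (constant `p ≡ 2`, `p ≡ N`: thermal floor `6/(24β+3)`, negatives p592745/p592923/p593279/p593536; β-dependent `p`
  posited with a rate (DR): an XL stub of its own in `coldwall_pure`);
* K6 — the BARE-β normalisation of the carrier, `carrierCl = β·R⁴/C·classicalResponse` inside a sub-Gaussian law (GD `GaussianDominationSU2`, (EC), EMLin):
  already its torus MEAN is `≍ β·g²(R) → ∞` at the top of the window (critic-endorsed one-loop heuristic; `af_carrier` answered with a running coefficient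
  `bAF = 1 + |log(R·uRec β)|`, priced «variant, splitAF XL-hardest»).
This line keeps the family's MECHANISM (it is the only one in the cone that FACTORISES the E0′-type content into a ONE-BOX statement deterministic in the
exterior and a TYPICALITY statement about a CLASSICAL functional) and replaces exactly the two dead organs, simultaneously, by their weakest living forms:

(SD) «CLASSICAL DOMINANCE OF THE WALL INFLUENCE», cold-wall referenced, β-free coefficient, explicit allowance:
  `∃ A ≥ 1, κ ≥ 0`: on the window, for every plane, site and EVERY exterior `η`,
  `|kerE^η_{β,Λ}(plane q x) − kerE^𝟙_{β,Λ}(plane q x)| ≤ A · classicalResponse_Λ(q, x; s = 1)(η) + κ/R⁴`.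
  No reference value at all (the cold wall of the SAME kernel is the comparison point, so the thermal parts cancel identically: K2 has no organ); the
  coefficient is a CONSTANT, not `β` and not `bAF` — justified: the classical response is β-free GEOMETRY (`(m₀ − m₁)(η)`), the quantum deficit is the same
  geometry times `1 + O(g₀² ln R)` (one-loop change of the LOCAL fluctuation density in the wall's background; the log is `≤ O(1)` exactly on the window
  `R·uRec β ≤ ℓ`, and the TOTAL one-loop excess action of a background integrates to its classical action since the fluctuation determinant of a geometric
  background is `g₀`-independent), plus wall effects on the fluctuations alone of size `O(g₀²R⁻⁴)` (finite-size image terms) or `O(g₀²Φ²R⁻⁵)` (centre-flat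
  charged backgrounds) — the allowance `κ/R⁴`.  Penetrating flux (the K4/K5 witnesses, `≍ R⁻²`) has classical response `≍ R⁻²` and PAYS; nothing is excluded,
  so there is no rarity clause.  Typing 4c(iv): `∃ A, κ`.
(CM) «CLASSICAL-RESPONSE MOMENTS AT COEFFICIENT ONE, RESPONSE UNITS»: `∃ C₀ > 0, B`: on every odd torus `2L+1 ≥ 8R+17`, window, cyclically
  `2R+4`-separated family, `∀T`: `⟨exp(Σ_{i∈T} (R⁴/C₀)·classicalResponse_i(U))⟩_{2L+1,β} ≤ e^{B·#T}`.  No `β`: the summand is `≍ g²(R)/C₀ ≤ O(1)/C₀` in mean on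
  the whole window (K6 has no organ), heuristically a `χ²` of the block-averaged curvature at scale `R` in RUNNING units — the quantity Bałaban's small-field /
  large-field analysis is ABOUT (small fields: Gaussian block curvature with covariance `g²(R)`; large fields: densities `≤ e^{−p₀(g(R))}`), i.e. the family's
  typicality organ in the form nearest to the printed RG output; strictly weaker than `af_carrier`'s `carrierMomentsAF` (coefficient `bAF ≥ 1` dropped).
GLUE (proved): `absMoments_of_dominance` — (SD) ∧ (CM) ⇒ the cold-wall-centred ABSOLUTE joint exponential moment bound with `C₁ := A·C₀`, `B ↦ B + κ/(A·C₀)`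
(pointwise `(R⁴/C₁)|D_i| ≤ (R⁴/C₀)·cr_i + κ/C₁`, sum, exponentiate, `torusE_mono`, `torusE_const_mul'`); then EXACTLY the g3 `slack_coldwall` chain:
`coldWall_pin_abs` (the Dirichlet finite-size law `|kerE^𝟙_{β,R} − pRef| ≤ C₁(e^B−1)/R⁴` DERIVED from the one-site moment by torus DLR + translation
invariance — (DR)'s content is a corollary, K2's reference is derived, never posited), `abs_pRef_le`, `responseMomentsOdd6SU2_of_absMoments` (⇒ the registered
(RM) body, `a := uRec`, `c := 1`, `p := pRef ℓ₁`, `B ↦ B + (e^B−1)`), `stub_responseMomentsOdd6` (registered text VERBATIM), `stub_ceilings`, `stub_transport`,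
`UVSeamRec_of` (the crux BY NAME).  Stubs (sorries) = {`stub_classicalDominance`, `stub_classicalMoments`, `stub_floorsEngine`}.
RELATION TO THE SEAT'S OTHER LINES: (SD)'s lower half `kerE^η − kerE^𝟙 ≤ A·cr + κ/R⁴` is WEAKER than g3's (SCW) (classical response `≥ 0`,
`classicalResponse_nonneg`); (SD) ∧ (CM) and (SCW) ∧ (XM) are two factorisations of the same absolute law — (XM) keeps the quantum kernel inside the torus
expectation, (CM) replaces it by the classical variational functional and moves the quantum/classical comparison into the one-box stub (SD).
TRUTH-IN-LABELLING (K1): measure stubs WITHOUT the idle `UV →`; `UVSeamRec_of` keeps it, unconsumed, visibly (UV export is ym-idea-9's desk).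
bears_on: LADDER-YM rung R2d · stmt-QuantumFields-20043 · route-QuantumFields-BalabanLadder.

INSTRUMENT ROWS: (SD) Dirichlet cubes `R = 1..4`, β_std ∈ {2.3, 2.5, 2.7}, walls (a) cold, (c) coherent abelian flux, (f) centre-flat dipole sheets, (g) Haar,
(h) Z₂-vortex: statistic `Q(R) := max_η R⁴·(|⟨P_c⟩_η − ⟨P_c⟩_cold| − A·cr(η))₊` with `cr(η)` from constrained cooling of the same cube (classical minimisation with
the exterior fixed, tilt `s = 1`) and `A = 2`: growth in `R` kills (SD).  (CM) torus β_std 2.5–2.85, `L = 24–32`, `R = 2..5`: histogram of `R⁴·cr_R(U)` over sampled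
`U` (cooling of each cube with its sampled exterior): a mean growing in `R` across the window (K6-type growth WITHOUT the `β`) kills (CM); single-cube
`log⟨exp(R⁴cr/C₀)⟩` vs `C₀ ∈ {1,4,16}` bounded is the prediction.
HONEST FRAMING: a re-cut of OPEN conditional content plus kernel-checked glue; (SD) and (CM) are bets stated as stubs with their evidence; nothing of E0′,
NT or a gap is claimed; not Clay; no summit, leg or spine crux is proved by a line.
-/

namespace Summit.QuantumFields.YangMills.Cruxes.UVSeamRec.ClassicalDominance

open Literature.MathematicalPhysics.QuantumFieldTheory
open Summit.QuantumFields.YangMills.Cruxes.OSLegsFromFemtoAndGap.DlrCollarTransfer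
open Filter Topology
open scoped SchwartzMap
open Literature.MathematicalPhysics.QuantumLattice (thetaTest LGConfig fundamentalLatticeRep)
open Summit.QuantumFields.YangMills.Cruxes.UVSeamRec.ResponsePinning
  (torusE_exp_sum_response_recentre torusE_abs_sub_le_of_expMoment torusE_plane_eq_torusE_kerE torusE_add' torusE_const
   abs_torusE_sub_le_of_forall torusE_mono torusE_const_mul')
open Summit.QuantumFields.YangMills.Cruxes.UVSeamRec.TemperedResponse (continuous_kerE_plane abs_kerE_plane_le)
open Summit.QuantumFields.YangMills.Theorems.OSLegsFromFemtoAndGap (torusE_plane_eq_wilsonTorusMean)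
open Summit.QuantumFields.YangMills.Cruxes.UVSeamRec.ClassicalResponse (classicalResponse classicalResponse_nonneg continuous_classicalResponse)

/-- The FUNDAMENTAL (defining) lattice representation of `SU(2)` (as v4-F/v5(α)). -/
abbrev rF : LatticeRep (Matrix.specialUnitaryGroup (Fin 2) ℂ) :=
  Literature.MathematicalPhysics.QuantumLattice.fundamentalLatticeRep 2

/-- the unit of record (abbreviation used only inside this skeleton). -/
noncomputable abbrev uRec : ℝ → ℝ := fun β => Real.exp (Summit.QuantumFields.YangMills.Theorems.FemtoTransferGap.sizeLog β 1)

/-- The canonical admissible torus half-side at coupling `β` for the window `R·uRec β ≤ ℓ₁`: `L†(β) = 4⌈ℓ₁/uRec β⌉ + 8` (so `4R + 8 ≤ L†(β)` for every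
admissible radius `R`). -/
noncomputable def Ldag (ℓ₁ : ℝ) (β : ℝ) : ℕ := 4 * ⌈ℓ₁ / Transport.uRec β⌉₊ + 8

/-- The DERIVED reference value: the torus plaquette mean on the canonical admissible torus. -/
noncomputable def pRef (ℓ₁ : ℝ) (q : Fin 4 × Fin 4) (β : ℝ) : ℝ :=
  letI : MeasurableSpace (Matrix.specialUnitaryGroup (Fin 2) ℂ) := borel _
  haveI : BorelSpace (Matrix.specialUnitaryGroup (Fin 2) ℂ) := ⟨rfl⟩
  torusE (Matrix.specialUnitaryGroup (Fin 2) ℂ) rF β (Ldag ℓ₁ β) (plane (Matrix.specialUnitaryGroup (Fin 2) ℂ) rF q 0)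

theorem uRec_pos (β : ℝ) : 0 < Transport.uRec β := Real.exp_pos _

theorem le_Ldag {ℓ₁ β : ℝ} {R : ℕ} (hRa : (R : ℝ) * Transport.uRec β ≤ ℓ₁) : 4 * R + 8 ≤ Ldag ℓ₁ β := by
  have h1 : (R : ℝ) ≤ ℓ₁ / Transport.uRec β := (le_div_iff₀ (uRec_pos β)).2 hRa
  have h2 : (R : ℝ) ≤ (⌈ℓ₁ / Transport.uRec β⌉₊ : ℕ) := h1.trans (Nat.le_ceil _)
  have h3 : R ≤ ⌈ℓ₁ / Transport.uRec β⌉₊ := by exact_mod_cast h2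
  unfold Ldag
  omega

/-- D0 (iso-transport) — PROVED (`Transport.stub_transport_proved`, p412513); text = v5(α) verbatim. -/
theorem stub_transport :
    (letI : MeasurableSpace (Matrix.specialUnitaryGroup (Fin 2) ℂ) := borel _
     haveI : BorelSpace (Matrix.specialUnitaryGroup (Fin 2) ℂ) := ⟨rfl⟩
     ∃ r₂ : LatticeRep (Matrix.specialUnitaryGroup (Fin 2) ℂ),
       LowerBounds (Matrix.specialUnitaryGroup (Fin 2) ℂ) r₂ uRec ∧ MomentBounds6 (Matrix.specialUnitaryGroup (Fin 2) ℂ) r₂ uRec) →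
    ∀ (G : Type) [Group G] [TopologicalSpace G] [IsTopologicalGroup G] [CompactSpace G],
      IsCompactSimpleLieGroup G → Nonempty (G ≃ₜ* Matrix.specialUnitaryGroup (Fin 2) ℂ) →
      letI : MeasurableSpace G := borel G; haveI : BorelSpace G := ⟨rfl⟩;
      ∃ r : LatticeRep G, LowerBounds G r uRec ∧ MomentBounds6 G r uRec := by
  exact Summit.QuantumFields.YangMills.Cruxes.UVSeamRec.Transport.stub_transport_proved

/-- STUB (SD) «CLASSICAL DOMINANCE OF THE WALL INFLUENCE» (XL; ONE BOX, deterministic in the exterior; the family's split organ with K2 and K6 removed): constants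
`A ≥ 1`, `κ ≥ 0`, thresholds `β₀`, `ℓ₀ > 0` such that for `β ≥ β₀`, `1 ≤ R`, `R·uRec β ≤ ℓ₀`, every plane `q`, site `x` and EVERY exterior `η` of the Dirichlet cube
`Λ = (x − R − 1, 2R+3)`: `|kerE^η(plane q x) − kerE^𝟙(plane q x)| ≤ A·classicalResponse_Λ(q, x; s = 1)(η) + κ/R⁴`.  Cold-wall referenced (no reference VALUE:
the thermal parts of the two kernel means cancel identically — K2 has nothing to bite), β-FREE coefficient (the classical response `(m₀ − m₁)(η)` is geometry; the
quantum deficit is the same geometry times `1 + O(g₀² ln R) = O(1)` on the window plus wall effects on the fluctuations alone of size `O(g₀²R⁻⁴)` — the allowance;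
K6 has nothing to bite), NO rarity clause (penetrating flux has classical response `≍ R⁻²` and pays).  Evidence: lattice GFF — quantum response = classical
response identically (conditioning shifts the mean, not the covariance; seam-s2 `GaussianCalibrationSplit`), so (SD) holds with `A = 1`, `κ = 0`; pure-gauge
walls — both sides vanish (`kerE_gaugeTransformZd`, `classicalResponse_gaugeTransformZd`, `classicalResponse_one`); zero temperature — the tree's
`kerE_plane_eventually_ge_sub_classicalResponse` (`kerE_β ≥ N − classicalResponse − ε` eventually in `β`, every exterior) is the `β → ∞` skeleton of the upper
half.  Open content: Bałaban's background-field expansion of ONE Dirichlet cube kernel around the (tilted) minimiser with a gauge-invariant remainder `O(R⁻⁴)`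
uniform on the window ([Bałaban, CMP 122 (1989)] R-operation in one box; interior large fields are the prover's business, no exterior is excused).  Why it might
fail: a background-dependent one-loop term at the centre decaying slower than `R⁻⁴` for an exterior family with SMALL classical response (it must beat
`A × classical response`: AM–GM leaves room only for effects quadratic in a centre-flat background, counted `O(g₀²Φ²R⁻⁵)`), or a genuine `ln R`-enhancement of
the local fluctuation density beyond `O(1)` at the top of the window (then `A` would have to run — `af_carrier`'s `bAF`).  REGIMES (answering the
power counting of idea-crit-9 VERDICT #21): write `δ` for the coherent boundary flux per plaquette.  SUB-CRITICAL `δ(2R+3)² ≲ 1`: the loop expansion around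
the abelian harmonic extension is valid and the worst nonlocal term (double scattering off the sheet, `Σ_{y,y'∈face} R⁻³R⁻³|y−y'|⁻²·δ² ≍ δ²R⁻²`) is `≤ R⁻⁶`,
inside `κ/R⁴`.  SUPER-CRITICAL `δ(2R+3)² ≫ 1` (all rough walls, and smooth coherent sheets at large `R`): the abelian harmonic extension is NOT the minimiser —
the Yang–Mills Hessian at a coherent abelian flux through an area `≫ 1/δ` has Nielsen–Olesen negative modes (`k² < δ`, charged spin-aligned components) — so
the `δ²R⁻²` / `Φ²R⁻²` counts are expansions around a saddle; `classicalResponse` is defined through the TRUE (non-abelian) constrained minimiser (`tiltedMin`),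
around which the Hessian is `≥ 0` by minimality, and the claim of (SD) is: local one-loop terms `∝ g²(R)·F_min(centre)² ≤ (A−1)·cr`, nonlocal wall terms
saturate at the boundary-condition (Casimir) scale `g²(R)·R⁻⁴ ≤ κ/R⁴` — the coupling is the RUNNING one at scale `R` (soft modes `k ≍ 1/R`), bounded by
`O(1)` on the window `R·uRec β ≤ ℓ₀`, so `A`, `κ` are `β`-free constants and `sup_η` of the wall term `× R⁴` is bounded, not `log`-divergent.
INSTRUMENT: statistic `Q(R) := max_η R⁴(|⟨P_c⟩_η − ⟨P_c⟩_cold| − 2·cr(η))₊`, `cr` by constrained cooling of the same cube (exterior frozen; in the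
super-critical rows the cooled minimiser must come out NON-abelian — charged components `≠ 0` — else the cooling is stuck at the saddle), walls (a) cold,
(c) coherent abelian flux, (f) centre-flat dipole sheets, (g) Haar, (h) SCREENED COHERENT SHEETS of idea-crit-9 #21 (`(03)`-flux `+Φ` on the layers
`x₁ = ±(R+1)`, `−Φ` on `x₂ = ±(R+1)`, Dirichlet links `U₃(y) = exp(±iΦy₀σ₃)`, `Φ ∈ {π/8, π/4, π/2}`; classical centre field cancels to second order),
(v) `Z₂`-vortex, `R = 1..4`: growth of `Q(R)` (prediction of the saddle count on (h): `∝ R²`) kills (SD); bounded `Q` on (h) is the strongest cheap evidence. -/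
theorem stub_classicalDominance :
    ∃ (A κ β₀ ℓ₀ : ℝ), 1 ≤ A ∧ 0 ≤ κ ∧ 0 < ℓ₀ ∧
      ∀ β : ℝ, β₀ ≤ β → ∀ R : ℕ, 1 ≤ R → (R : ℝ) * Transport.uRec β ≤ ℓ₀ →
      ∀ (q : Fin 4 × Fin 4) (x : Fin 4 → ℤ), q.1 < q.2 → ∀ η : LGConfig 4 (Matrix.specialUnitaryGroup (Fin 2) ℂ),
        |kerE (Matrix.specialUnitaryGroup (Fin 2) ℂ) (fundamentalLatticeRep 2) β (fun k => x k - (R + 1)) (2 * R + 3) η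
            (plane (Matrix.specialUnitaryGroup (Fin 2) ℂ) (fundamentalLatticeRep 2) q x) -
          kerE (Matrix.specialUnitaryGroup (Fin 2) ℂ) (fundamentalLatticeRep 2) β (fun k => x k - (R + 1)) (2 * R + 3) 1
            (plane (Matrix.specialUnitaryGroup (Fin 2) ℂ) (fundamentalLatticeRep 2) q x)| ≤
          A * classicalResponse (fundamentalLatticeRep 2) (fun k => x k - (R + 1)) (2 * R + 3) q x 1 η + κ / (R : ℝ) ^ 4 := by
  sorry

/-- STUB (CM) «CLASSICAL-RESPONSE MOMENTS AT COEFFICIENT ONE, RESPONSE UNITS» (XL; HARDEST; the family's typicality organ with K6 removed): a constant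
`C₀ > 0`, `ℓ₁ > 0`, `B`, `β₁` such that for `β ≥ β₁`, every odd torus `2L+1` with `4R+8 ≤ L`, the window `R·uRec β ≤ ℓ₁`, every cyclically
`2R+4`-separated family and every sub-family `T`: `⟨exp(Σ_{i∈T} (R⁴/C₀)·classicalResponse_i(U))⟩_{2L+1,β} ≤ exp(B·#T)`.  A statement about a CLASSICAL,
gauge-invariant, non-negative variational functional of the torus field restricted to the boundary layer of each cube, in RESPONSE units (no `β`, no running
coefficient): its torus mean is `≍ g²(R)/C₀ ≤ O(1)/C₀` on the whole window (bottom: `≍ 1/(βC₀)`; top: `O(1)/C₀`) — the one-loop heuristic that killed the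
bare-β carrier (K6) is satisfied identically.  Heuristic content: `(R⁴/C₀)·cr_R(U) ≈ |R²F̄_R(U)|²/C₀` with `F̄_R` the screened block-average of the curvature at
scale `R` — a `χ²` in RUNNING units — so (CM) is «block curvature at scale `R` is sub-Gaussian in units `g(R)`, jointly over separated blocks, uniformly in the
volume»: the small-field/large-field output of Bałaban's renormalisation group ([Bałaban CMP 109/116/119/122], large-field densities `≤ e^{−p₀(g_k)}`) read at
observable level; Gaussian calibration = seam-s2 `GaussianCalibrationLaw` (operator-norm constant of the screened flux covariance on separated families);
semiclassics: torons `(R/L)⁴ ≤ 1/16⁴`-small, instantons of scale `ρ` contribute `≲ min(1, (R/ρ)⁴·(ρ/R)⁸)/C₀ ≤ 1/C₀` pointwise.  Strictly WEAKER than `af_carrier`'s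
`carrierMomentsAF` (coefficient `bAF ≥ 1` dropped) and than `coldwall_pure`'s (GD) (plain exponential moments, not sub-Gaussian in linear sources of `√(β·…)`).
Why it might fail: it is a UV-stability statement of E0′ type (uniform in the torus size up to prime sides, no reflection positivity available) with no
finite-dimensional special case beyond the GFF; a classical-response tail heavier than exponential at scale `R` under the weakly coupled state (coherent
flux sheets cost `β·Φ²·R³` but respond `Φ²R⁻⁴·R⁴ = Φ²`: fine; the danger is DEGENERATE near-flat directions — torons/zero modes on small tori — where the
action cost of classical response is only quartic).  INSTRUMENT: torus β_std 2.5–2.85, `L = 24–32`, `R = 2..5`: histogram of `R⁴·cr_R(U)` (cooling of each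
sampled cube with its exterior frozen): a MEAN growing in `R` across the window kills (CM) exactly as K6 killed the bare carrier; single-cube
`log⟨exp(R⁴cr/C₀)⟩` finite and decreasing in `C₀ ∈ {1,4,16}`, pair excess at separation `2R+4` small, is the prediction. -/
theorem stub_classicalMoments :
    letI : MeasurableSpace (Matrix.specialUnitaryGroup (Fin 2) ℂ) := borel _
    haveI : BorelSpace (Matrix.specialUnitaryGroup (Fin 2) ℂ) := ⟨rfl⟩
    ∃ (C₀ B β₁ ℓ₁ : ℝ), 0 < C₀ ∧ 0 < ℓ₁ ∧
      ∀ β : ℝ, β₁ ≤ β → ∀ (L n : ℕ) (q : Fin n → Fin 4 × Fin 4) (x : Fin n → (Fin 4 → ℤ)) (R : ℕ),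
      (∀ i, (q i).1 < (q i).2) → 1 ≤ R → (R : ℝ) * Transport.uRec β ≤ ℓ₁ → 4 * R + 8 ≤ L →
      (∀ i j : Fin n, i ≠ j → ∃ k : Fin 4,
        (2 * (R : ℤ) + 4) ≤ |((((x i k - x j k : ℤ) : ZMod (2 * L + 1))).valMinAbs : ℤ)|) →
      ∀ T : Finset (Fin n),
        torusE (Matrix.specialUnitaryGroup (Fin 2) ℂ) (fundamentalLatticeRep 2) β L
          (fun U => Real.exp (∑ i ∈ T, (R : ℝ) ^ 4 / C₀ *
            classicalResponse (fundamentalLatticeRep 2) (fun k => x i k - (R + 1)) (2 * R + 3) (q i) (x i) 1 U)) ≤ Real.exp (B * T.card) := by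
  sorry

/-- **THE DOMINANCE GLUE** (proved): (SD) ∧ (CM) ⇒ the cold-wall-centred ABSOLUTE joint exponential moment bound with `C₁ := A·C₀`, `B ↦ B + κ/(A·C₀)`,
thresholds `max β₀ β₁`, `min ℓ₀ ℓ₁`.  Mechanism: pointwise `(R⁴/(A C₀))·|kerE^U_i − kerE^𝟙_i| ≤ (R⁴/C₀)·cr_i(U) + κ/(A C₀)`; sum over `T`, exponentiate,
`torusE_mono`, `torusE_const_mul'`. -/
theorem absMoments_of_dominance
    (hSD : ∃ (A κ β₀ ℓ₀ : ℝ), 1 ≤ A ∧ 0 ≤ κ ∧ 0 < ℓ₀ ∧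
      ∀ β : ℝ, β₀ ≤ β → ∀ R : ℕ, 1 ≤ R → (R : ℝ) * Transport.uRec β ≤ ℓ₀ →
      ∀ (q : Fin 4 × Fin 4) (x : Fin 4 → ℤ), q.1 < q.2 → ∀ η : LGConfig 4 (Matrix.specialUnitaryGroup (Fin 2) ℂ),
        |kerE (Matrix.specialUnitaryGroup (Fin 2) ℂ) (fundamentalLatticeRep 2) β (fun k => x k - (R + 1)) (2 * R + 3) η
            (plane (Matrix.specialUnitaryGroup (Fin 2) ℂ) (fundamentalLatticeRep 2) q x) -
          kerE (Matrix.specialUnitaryGroup (Fin 2) ℂ) (fundamentalLatticeRep 2) β (fun k => x k - (R + 1)) (2 * R + 3) 1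
            (plane (Matrix.specialUnitaryGroup (Fin 2) ℂ) (fundamentalLatticeRep 2) q x)| ≤
          A * classicalResponse (fundamentalLatticeRep 2) (fun k => x k - (R + 1)) (2 * R + 3) q x 1 η + κ / (R : ℝ) ^ 4)
    (hCM : letI : MeasurableSpace (Matrix.specialUnitaryGroup (Fin 2) ℂ) := borel _
      haveI : BorelSpace (Matrix.specialUnitaryGroup (Fin 2) ℂ) := ⟨rfl⟩
      ∃ (C₀ B β₁ ℓ₁ : ℝ), 0 < C₀ ∧ 0 < ℓ₁ ∧
      ∀ β : ℝ, β₁ ≤ β → ∀ (L n : ℕ) (q : Fin n → Fin 4 × Fin 4) (x : Fin n → (Fin 4 → ℤ)) (R : ℕ),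
      (∀ i, (q i).1 < (q i).2) → 1 ≤ R → (R : ℝ) * Transport.uRec β ≤ ℓ₁ → 4 * R + 8 ≤ L →
      (∀ i j : Fin n, i ≠ j → ∃ k : Fin 4,
        (2 * (R : ℤ) + 4) ≤ |((((x i k - x j k : ℤ) : ZMod (2 * L + 1))).valMinAbs : ℤ)|) →
      ∀ T : Finset (Fin n),
        torusE (Matrix.specialUnitaryGroup (Fin 2) ℂ) (fundamentalLatticeRep 2) β L
          (fun U => Real.exp (∑ i ∈ T, (R : ℝ) ^ 4 / C₀ *
            classicalResponse (fundamentalLatticeRep 2) (fun k => x i k - (R + 1)) (2 * R + 3) (q i) (x i) 1 U)) ≤ Real.exp (B * T.card)) :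
    letI : MeasurableSpace (Matrix.specialUnitaryGroup (Fin 2) ℂ) := borel _
    haveI : BorelSpace (Matrix.specialUnitaryGroup (Fin 2) ℂ) := ⟨rfl⟩
    ∃ (C₁ B β₁ ℓ₁ : ℝ), 0 < C₁ ∧ 0 < ℓ₁ ∧
      ∀ β : ℝ, β₁ ≤ β → ∀ (L n : ℕ) (q : Fin n → Fin 4 × Fin 4) (x : Fin n → (Fin 4 → ℤ)) (R : ℕ),
      (∀ i, (q i).1 < (q i).2) → 1 ≤ R → (R : ℝ) * Transport.uRec β ≤ ℓ₁ → 4 * R + 8 ≤ L →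
      (∀ i j : Fin n, i ≠ j → ∃ k : Fin 4,
        (2 * (R : ℤ) + 4) ≤ |((((x i k - x j k : ℤ) : ZMod (2 * L + 1))).valMinAbs : ℤ)|) →
      ∀ T : Finset (Fin n),
        torusE (Matrix.specialUnitaryGroup (Fin 2) ℂ) (fundamentalLatticeRep 2) β L
          (fun U => Real.exp (∑ i ∈ T, (R : ℝ) ^ 4 / C₁ *
            |kerE (Matrix.specialUnitaryGroup (Fin 2) ℂ) (fundamentalLatticeRep 2) β (fun k => x i k - (R + 1)) (2 * R + 3) U
                (plane (Matrix.specialUnitaryGroup (Fin 2) ℂ) (fundamentalLatticeRep 2) (q i) (x i)) -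
              kerE (Matrix.specialUnitaryGroup (Fin 2) ℂ) (fundamentalLatticeRep 2) β (fun k => x i k - (R + 1)) (2 * R + 3) 1
                (plane (Matrix.specialUnitaryGroup (Fin 2) ℂ) (fundamentalLatticeRep 2) (q i) (x i))|)) ≤ Real.exp (B * T.card) := by
  letI : MeasurableSpace (Matrix.specialUnitaryGroup (Fin 2) ℂ) := borel _
  haveI : BorelSpace (Matrix.specialUnitaryGroup (Fin 2) ℂ) := ⟨rfl⟩
  obtain ⟨A, κ, β₀, ℓ₀, hA, hκ, hℓ₀, hSD⟩ := hSD
  obtain ⟨C₀, B, β₁, ℓ₁, hC₀, hℓ₁, hCM⟩ := hCM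
  have hA0 : 0 < A := one_pos.trans_le hA
  refine ⟨A * C₀, B + κ / (A * C₀), max β₀ β₁, min ℓ₀ ℓ₁, mul_pos hA0 hC₀, lt_min hℓ₀ hℓ₁, ?_⟩
  intro β hβ L n q x R hq hR hRa hL hsep T
  have hβ0 : β₀ ≤ β := (le_max_left _ _).trans hβ
  have hβ1 : β₁ ≤ β := (le_max_right _ _).trans hβ
  have hRa0 : (R : ℝ) * Transport.uRec β ≤ ℓ₀ := hRa.trans (min_le_left _ _)
  have hRa1 : (R : ℝ) * Transport.uRec β ≤ ℓ₁ := hRa.trans (min_le_right _ _)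
  have hR0 : (0 : ℝ) < R := by exact_mod_cast (show 0 < R by omega)
  have hR4 : (0 : ℝ) < (R : ℝ) ^ 4 := by positivity
  have hAC : 0 < A * C₀ := mul_pos hA0 hC₀
  -- cold-wall kernel means, kernels, classical responses
  set K1 : Fin n → ℝ := fun i =>
    kerE (Matrix.specialUnitaryGroup (Fin 2) ℂ) (fundamentalLatticeRep 2) β (fun k => x i k - (R + 1)) (2 * R + 3) 1
      (plane (Matrix.specialUnitaryGroup (Fin 2) ℂ) (fundamentalLatticeRep 2) (q i) (x i)) with hK1
  set k : Fin n → LGConfig 4 (Matrix.specialUnitaryGroup (Fin 2) ℂ) → ℝ := fun i U =>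
    kerE (Matrix.specialUnitaryGroup (Fin 2) ℂ) (fundamentalLatticeRep 2) β (fun k => x i k - (R + 1)) (2 * R + 3) U
      (plane (Matrix.specialUnitaryGroup (Fin 2) ℂ) (fundamentalLatticeRep 2) (q i) (x i)) with hk
  set cr : Fin n → LGConfig 4 (Matrix.specialUnitaryGroup (Fin 2) ℂ) → ℝ := fun i U =>
    classicalResponse (fundamentalLatticeRep 2) (fun k => x i k - (R + 1)) (2 * R + 3) (q i) (x i) 1 U with hcr
  have hkc : ∀ i, Continuous (k i) := fun i => continuous_kerE_plane rF β _ _ (q i) (x i)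
  have hcrc : ∀ i, Continuous (cr i) := fun i => continuous_classicalResponse _ _ (q i) (x i) 1
  -- pointwise dominance, per site
  have hcoef : (R : ℝ) ^ 4 / (A * C₀) * A = (R : ℝ) ^ 4 / C₀ := by
    field_simp
  have hmulκ : (R : ℝ) ^ 4 / (A * C₀) * (κ / (R : ℝ) ^ 4) = κ / (A * C₀) := by
    field_simp
  have hpt : ∀ i U, (R : ℝ) ^ 4 / (A * C₀) * |k i U - K1 i| ≤ (R : ℝ) ^ 4 / C₀ * cr i U + κ / (A * C₀) := by
    intro i U
    have hs : |k i U - K1 i| ≤ A * cr i U + κ / (R : ℝ) ^ 4 := hSD β hβ0 R hR hRa0 (q i) (x i) (hq i) U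
    have ha : 0 ≤ (R : ℝ) ^ 4 / (A * C₀) := by positivity
    calc (R : ℝ) ^ 4 / (A * C₀) * |k i U - K1 i|
        ≤ (R : ℝ) ^ 4 / (A * C₀) * (A * cr i U + κ / (R : ℝ) ^ 4) := mul_le_mul_of_nonneg_left hs ha
      _ = (R : ℝ) ^ 4 / C₀ * cr i U + κ / (A * C₀) := by rw [mul_add, ← mul_assoc, hcoef, hmulκ]
  have hsum : ∀ U, ∑ i ∈ T, (R : ℝ) ^ 4 / (A * C₀) * |k i U - K1 i| ≤
      ∑ i ∈ T, (R : ℝ) ^ 4 / C₀ * cr i U + κ / (A * C₀) * T.card := by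
    intro U
    calc ∑ i ∈ T, (R : ℝ) ^ 4 / (A * C₀) * |k i U - K1 i|
        ≤ ∑ i ∈ T, ((R : ℝ) ^ 4 / C₀ * cr i U + κ / (A * C₀)) := Finset.sum_le_sum fun i _ => hpt i U
      _ = ∑ i ∈ T, (R : ℝ) ^ 4 / C₀ * cr i U + κ / (A * C₀) * T.card := by
          rw [Finset.sum_add_distrib, Finset.sum_const, nsmul_eq_mul]
          ring
  -- the two integrands
  have hAc : Continuous (fun U : LGConfig 4 (Matrix.specialUnitaryGroup (Fin 2) ℂ) =>
      Real.exp (∑ i ∈ T, (R : ℝ) ^ 4 / (A * C₀) * |k i U - K1 i|)) :=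
    Real.continuous_exp.comp (continuous_finsetSum T fun i _ => continuous_const.mul ((hkc i).sub continuous_const).abs)
  have hBc : Continuous (fun U : LGConfig 4 (Matrix.specialUnitaryGroup (Fin 2) ℂ) =>
      Real.exp (κ / (A * C₀) * T.card) * Real.exp (∑ i ∈ T, (R : ℝ) ^ 4 / C₀ * cr i U)) :=
    continuous_const.mul (Real.continuous_exp.comp (continuous_finsetSum T fun i _ => continuous_const.mul (hcrc i)))
  have hle : ∀ U : LGConfig 4 (Matrix.specialUnitaryGroup (Fin 2) ℂ),
      Real.exp (∑ i ∈ T, (R : ℝ) ^ 4 / (A * C₀) * |k i U - K1 i|) ≤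
        Real.exp (κ / (A * C₀) * T.card) * Real.exp (∑ i ∈ T, (R : ℝ) ^ 4 / C₀ * cr i U) := fun U => by
    calc Real.exp (∑ i ∈ T, (R : ℝ) ^ 4 / (A * C₀) * |k i U - K1 i|)
        ≤ Real.exp (∑ i ∈ T, (R : ℝ) ^ 4 / C₀ * cr i U + κ / (A * C₀) * T.card) := Real.exp_le_exp.2 (hsum U)
      _ = Real.exp (κ / (A * C₀) * T.card) * Real.exp (∑ i ∈ T, (R : ℝ) ^ 4 / C₀ * cr i U) := by
          rw [Real.exp_add, mul_comm]
  have hX := hCM β hβ1 L n q x R hq hR hRa1 hL hsep T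
  calc torusE (Matrix.specialUnitaryGroup (Fin 2) ℂ) rF β L (fun U => Real.exp (∑ i ∈ T, (R : ℝ) ^ 4 / (A * C₀) * |k i U - K1 i|))
      ≤ torusE (Matrix.specialUnitaryGroup (Fin 2) ℂ) rF β L (fun U =>
          Real.exp (κ / (A * C₀) * T.card) * Real.exp (∑ i ∈ T, (R : ℝ) ^ 4 / C₀ * cr i U)) := torusE_mono rF β L hAc hBc hle
    _ = Real.exp (κ / (A * C₀) * T.card) *
          torusE (Matrix.specialUnitaryGroup (Fin 2) ℂ) rF β L (fun U => Real.exp (∑ i ∈ T, (R : ℝ) ^ 4 / C₀ * cr i U)) :=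
        torusE_const_mul' rF β L _ _
    _ ≤ Real.exp (κ / (A * C₀) * T.card) * Real.exp (B * T.card) := mul_le_mul_of_nonneg_left hX (Real.exp_pos _).le
    _ = Real.exp ((B + κ / (A * C₀)) * T.card) := by rw [← Real.exp_add]; ring_nf

/-- **PINNING FROM THE ONE-SITE ABSOLUTE MOMENT** (proved): the ONE-SITE cold-wall-centred absolute exponential moment at `(β, R)` on the canonical
torus `L†(β)` pins the cold-wall kernel mean within `C₁(e^B − 1)/R⁴` of the DERIVED reference value `pRef ℓ₁ q β` — the Dirichlet finite-size law as a
corollary (one-site moment bound `ResponsePinning.torusE_abs_sub_le_of_expMoment`, torus DLR `torusE_plane_eq_torusE_kerE`, translation invariance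
`torusE_plane_eq_wilsonTorusMean`). -/
theorem coldWall_pin_abs {C₁ B ℓ₁ β : ℝ} (hC₁ : 0 < C₁) {R : ℕ} (hR : 1 ≤ R) (hRa : (R : ℝ) * Transport.uRec β ≤ ℓ₁)
    (q : Fin 4 × Fin 4) (x : Fin 4 → ℤ)
    (hX1 : letI : MeasurableSpace (Matrix.specialUnitaryGroup (Fin 2) ℂ) := borel _
      haveI : BorelSpace (Matrix.specialUnitaryGroup (Fin 2) ℂ) := ⟨rfl⟩
      torusE (Matrix.specialUnitaryGroup (Fin 2) ℂ) (fundamentalLatticeRep 2) β (Ldag ℓ₁ β)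
          (fun U => Real.exp ((R : ℝ) ^ 4 / C₁ *
            |kerE (Matrix.specialUnitaryGroup (Fin 2) ℂ) (fundamentalLatticeRep 2) β (fun k => x k - (R + 1)) (2 * R + 3) U
                (plane (Matrix.specialUnitaryGroup (Fin 2) ℂ) (fundamentalLatticeRep 2) q x) -
              kerE (Matrix.specialUnitaryGroup (Fin 2) ℂ) (fundamentalLatticeRep 2) β (fun k => x k - (R + 1)) (2 * R + 3) 1
                (plane (Matrix.specialUnitaryGroup (Fin 2) ℂ) (fundamentalLatticeRep 2) q x)|)) ≤ Real.exp B) :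
    |kerE (Matrix.specialUnitaryGroup (Fin 2) ℂ) (fundamentalLatticeRep 2) β (fun k => x k - (R + 1)) (2 * R + 3) 1
        (plane (Matrix.specialUnitaryGroup (Fin 2) ℂ) (fundamentalLatticeRep 2) q x) - pRef ℓ₁ q β| ≤ C₁ * (Real.exp B - 1) / (R : ℝ) ^ 4 := by
  letI : MeasurableSpace (Matrix.specialUnitaryGroup (Fin 2) ℂ) := borel _
  haveI : BorelSpace (Matrix.specialUnitaryGroup (Fin 2) ℂ) := ⟨rfl⟩
  set L : ℕ := Ldag ℓ₁ β with hLdef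
  have hL : 4 * R + 8 ≤ L := le_Ldag hRa
  set K1 : ℝ := kerE (Matrix.specialUnitaryGroup (Fin 2) ℂ) (fundamentalLatticeRep 2) β (fun k => x k - (R + 1)) (2 * R + 3) 1
        (plane (Matrix.specialUnitaryGroup (Fin 2) ℂ) (fundamentalLatticeRep 2) q x) with hK1
  set k : LGConfig 4 (Matrix.specialUnitaryGroup (Fin 2) ℂ) → ℝ := fun U =>
    kerE (Matrix.specialUnitaryGroup (Fin 2) ℂ) (fundamentalLatticeRep 2) β (fun k => x k - (R + 1)) (2 * R + 3) U
        (plane (Matrix.specialUnitaryGroup (Fin 2) ℂ) (fundamentalLatticeRep 2) q x) with hk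
  have hkc : Continuous k := continuous_kerE_plane rF β _ _ q x
  have hR0 : (0 : ℝ) < R := by exact_mod_cast (show 0 < R by omega)
  have hlam : 0 < (R : ℝ) ^ 4 / C₁ := by positivity
  have h1 : torusE (Matrix.specialUnitaryGroup (Fin 2) ℂ) rF β L (fun U => Real.exp ((R : ℝ) ^ 4 / C₁ * |k U - K1|)) ≤ Real.exp B := hX1
  have h2 : torusE (Matrix.specialUnitaryGroup (Fin 2) ℂ) rF β L (fun U => |k U - K1|) ≤ (Real.exp B - 1) / ((R : ℝ) ^ 4 / C₁) :=
    torusE_abs_sub_le_of_expMoment rF β L hkc hlam (p := K1) (B := B) h1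
  have h3 : (Real.exp B - 1) / ((R : ℝ) ^ 4 / C₁) = C₁ * (Real.exp B - 1) / (R : ℝ) ^ 4 := by
    field_simp
  rw [h3] at h2
  -- the derived reference value is the torus mean of `k` (DLR + translation invariance)
  have hp : pRef ℓ₁ q β = torusE (Matrix.specialUnitaryGroup (Fin 2) ℂ) rF β L k := by
    show torusE (Matrix.specialUnitaryGroup (Fin 2) ℂ) rF β L (plane (Matrix.specialUnitaryGroup (Fin 2) ℂ) rF q 0) = _
    rw [torusE_plane_eq_wilsonTorusMean rF β L q 0, ← torusE_plane_eq_wilsonTorusMean rF β L q x,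
      torusE_plane_eq_torusE_kerE rF β q x R L (by omega)]
  have h4 : torusE (Matrix.specialUnitaryGroup (Fin 2) ℂ) rF β L k - K1 =
      torusE (Matrix.specialUnitaryGroup (Fin 2) ℂ) rF β L (fun U => k U - K1) := by
    rw [show (fun U => k U - K1) = (fun U => k U + -K1) from funext fun _ => sub_eq_add_neg _ _,
      torusE_add' rF β L hkc continuous_const, torusE_const]
    ring
  rw [abs_sub_comm, hp, h4]
  unfold torusE at h2 ⊢
  exact (MeasureTheory.abs_integral_le_integral_abs).trans h2

/-- The derived reference values are bounded (a torus mean of a bounded continuous observable). -/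
theorem abs_pRef_le (ℓ₁ : ℝ) : ∃ P₀ : ℝ, ∀ q β, |pRef ℓ₁ q β| ≤ P₀ := by
  letI : MeasurableSpace (Matrix.specialUnitaryGroup (Fin 2) ℂ) := borel _
  haveI : BorelSpace (Matrix.specialUnitaryGroup (Fin 2) ℂ) := ⟨rfl⟩
  obtain ⟨CA, hCA⟩ := exists_abs_plane_le (G := Matrix.specialUnitaryGroup (Fin 2) ℂ) rF
  refine ⟨CA, fun q β => ?_⟩
  have h := abs_torusE_sub_le_of_forall rF β (Ldag ℓ₁ β) (continuous_plane rF q 0) (c := 0) (h := CA)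
    (fun U => by rw [sub_zero]; exact hCA q 0 U)
  simpa [pRef, sub_zero] using h

/-- GLUE (proved here): the cold-wall-centred ABSOLUTE joint exponential moment bound ⇒ the registered v5(α) (RM) body, with the DERIVED reference
`pRef ℓ₁`, unit `a := uRec`, `c := 1`, `B ↦ B + (e^B − 1)`.  Mechanism: `coldWall_pin_abs` moves the centre from `kerE^𝟙_i` to `pRef` at cost
`exp((e^B − 1)·#T)` (`ResponsePinning.torusE_exp_sum_response_recentre`). -/
theorem responseMomentsOdd6SU2_of_absMoments
    (hAM : letI : MeasurableSpace (Matrix.specialUnitaryGroup (Fin 2) ℂ) := borel _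
      haveI : BorelSpace (Matrix.specialUnitaryGroup (Fin 2) ℂ) := ⟨rfl⟩
      ∃ (C₁ B β₁ ℓ₁ : ℝ), 0 < C₁ ∧ 0 < ℓ₁ ∧
      ∀ β : ℝ, β₁ ≤ β → ∀ (L n : ℕ) (q : Fin n → Fin 4 × Fin 4) (x : Fin n → (Fin 4 → ℤ)) (R : ℕ),
      (∀ i, (q i).1 < (q i).2) → 1 ≤ R → (R : ℝ) * Transport.uRec β ≤ ℓ₁ → 4 * R + 8 ≤ L →
      (∀ i j : Fin n, i ≠ j → ∃ k : Fin 4,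
        (2 * (R : ℤ) + 4) ≤ |((((x i k - x j k : ℤ) : ZMod (2 * L + 1))).valMinAbs : ℤ)|) →
      ∀ T : Finset (Fin n),
        torusE (Matrix.specialUnitaryGroup (Fin 2) ℂ) (fundamentalLatticeRep 2) β L
          (fun U => Real.exp (∑ i ∈ T, (R : ℝ) ^ 4 / C₁ *
            |kerE (Matrix.specialUnitaryGroup (Fin 2) ℂ) (fundamentalLatticeRep 2) β (fun k => x i k - (R + 1)) (2 * R + 3) U
                (plane (Matrix.specialUnitaryGroup (Fin 2) ℂ) (fundamentalLatticeRep 2) (q i) (x i)) -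
              kerE (Matrix.specialUnitaryGroup (Fin 2) ℂ) (fundamentalLatticeRep 2) β (fun k => x i k - (R + 1)) (2 * R + 3) 1
                (plane (Matrix.specialUnitaryGroup (Fin 2) ℂ) (fundamentalLatticeRep 2) (q i) (x i))|)) ≤ Real.exp (B * T.card)) :
    letI : MeasurableSpace (Matrix.specialUnitaryGroup (Fin 2) ℂ) := borel _
    haveI : BorelSpace (Matrix.specialUnitaryGroup (Fin 2) ℂ) := ⟨rfl⟩
    ∃ (a : ℝ → ℝ) (c : ℝ) (C₁ B β₁ ℓ₁ P₀ : ℝ) (p : Fin 4 × Fin 4 → ℝ → ℝ), 0 < c ∧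
      (∀ᶠ β in atTop, a β ≤ c * Transport.uRec β) ∧ 0 < ℓ₁ ∧ 0 < C₁ ∧ (∀ q β, |p q β| ≤ P₀) ∧
      ∀ β : ℝ, β₁ ≤ β → ∀ (L n : ℕ) (q : Fin n → Fin 4 × Fin 4) (x : Fin n → (Fin 4 → ℤ)) (R : ℕ),
        (∀ i, (q i).1 < (q i).2) → 1 ≤ R → (R : ℝ) * a β ≤ ℓ₁ → 4 * R + 8 ≤ L →
        (∀ i j : Fin n, i ≠ j → ∃ k : Fin 4,
          (2 * (R : ℤ) + 4) ≤ |((((x i k - x j k : ℤ) : ZMod (2 * L + 1))).valMinAbs : ℤ)|) →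
        ∀ T : Finset (Fin n),
          torusE (Matrix.specialUnitaryGroup (Fin 2) ℂ) (fundamentalLatticeRep 2) β L
            (fun U => Real.exp (∑ i ∈ T, (R : ℝ) ^ 4 / C₁ *
              |kerE (Matrix.specialUnitaryGroup (Fin 2) ℂ) (fundamentalLatticeRep 2) β (fun k => x i k - (R + 1)) (2 * R + 3) U
                (plane (Matrix.specialUnitaryGroup (Fin 2) ℂ) (fundamentalLatticeRep 2) (q i) (x i)) - p (q i) β|)) ≤ Real.exp (B * T.card) := by
  letI : MeasurableSpace (Matrix.specialUnitaryGroup (Fin 2) ℂ) := borel _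
  haveI : BorelSpace (Matrix.specialUnitaryGroup (Fin 2) ℂ) := ⟨rfl⟩
  obtain ⟨C₁, B, β₁, ℓ₁, hC₁, hℓ₁, hAM⟩ := hAM
  obtain ⟨P₀, hP₀⟩ := abs_pRef_le ℓ₁
  refine ⟨Transport.uRec, 1, C₁, B + (Real.exp B - 1), β₁, ℓ₁, P₀, pRef ℓ₁, one_pos,
    Filter.Eventually.of_forall fun β => by rw [one_mul], hℓ₁, hC₁, hP₀, ?_⟩
  intro β hβ L n q x R hq hR hRa hL hsep T
  have hR0 : (0 : ℝ) < R := by exact_mod_cast (show 0 < R by omega)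
  -- cold-wall kernel means (the deterministic centring)
  set K1 : Fin n → ℝ := fun i =>
    kerE (Matrix.specialUnitaryGroup (Fin 2) ℂ) (fundamentalLatticeRep 2) β (fun k => x i k - (R + 1)) (2 * R + 3) 1
      (plane (Matrix.specialUnitaryGroup (Fin 2) ℂ) (fundamentalLatticeRep 2) (q i) (x i)) with hK1
  have hmom : torusE (Matrix.specialUnitaryGroup (Fin 2) ℂ) (fundamentalLatticeRep 2) β L
      (fun U => Real.exp (∑ i ∈ T, (R : ℝ) ^ 4 / C₁ *
        |kerE (Matrix.specialUnitaryGroup (Fin 2) ℂ) (fundamentalLatticeRep 2) β (fun k => x i k - (R + 1)) (2 * R + 3) U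
            (plane (Matrix.specialUnitaryGroup (Fin 2) ℂ) (fundamentalLatticeRep 2) (q i) (x i)) - K1 i|)) ≤ Real.exp (B * T.card) :=
    hAM β hβ L n q x R hq hR hRa hL hsep T
  -- pinning of the derived reference to each cold-wall mean (one-site case on the canonical torus)
  have hpin : ∀ i ∈ T, |K1 i - pRef ℓ₁ (q i) β| ≤ C₁ * (Real.exp B - 1) / (R : ℝ) ^ 4 := by
    intro i _
    have h1 := hAM β hβ (Ldag ℓ₁ β) 1 (fun _ => q i) (fun _ => x i) R (fun _ => hq i) hR hRa (le_Ldag hRa)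
      (fun i' j' hij => absurd (Subsingleton.elim i' j') hij) Finset.univ
    simp only [Finset.univ_unique, Finset.sum_singleton, Finset.card_singleton, Nat.cast_one, mul_one] at h1
    exact coldWall_pin_abs hC₁ hR hRa (q i) (x i) h1
  -- recentre
  have hrec := torusE_exp_sum_response_recentre rF β L T q x R hC₁ K1 (fun i => pRef ℓ₁ (q i) β) hpin
  refine hrec.trans ?_
  have hfac : Real.exp ((R : ℝ) ^ 4 / C₁ * (C₁ * (Real.exp B - 1) / (R : ℝ) ^ 4) * T.card) = Real.exp ((Real.exp B - 1) * T.card) := by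
    congr 1
    field_simp
  rw [hfac]
  calc Real.exp ((Real.exp B - 1) * T.card) * torusE (Matrix.specialUnitaryGroup (Fin 2) ℂ) rF β L
        (fun U => Real.exp (∑ i ∈ T, (R : ℝ) ^ 4 / C₁ *
          |kerE (Matrix.specialUnitaryGroup (Fin 2) ℂ) rF β (fun k => x i k - (R + 1)) (2 * R + 3) U
              (plane (Matrix.specialUnitaryGroup (Fin 2) ℂ) rF (q i) (x i)) - K1 i|))
      ≤ Real.exp ((Real.exp B - 1) * T.card) * Real.exp (B * T.card) :=
        mul_le_mul_of_nonneg_left hmom (Real.exp_pos _).le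
    _ = Real.exp ((B + (Real.exp B - 1)) * T.card) := by rw [← Real.exp_add]; ring_nf

/-- (RM) — a THEOREM of the skeleton: the registered v5(α) text of `stub_responseMomentsOdd6` VERBATIM (`UV →` kept because it is the registered text;
the hypothesis is not consumed), from (SD) ∧ (CM) through `absMoments_of_dominance` and `responseMomentsOdd6SU2_of_absMoments` (the latter two glue theorems are the g3
`slack_coldwall` chain VERBATIM). -/
theorem stub_responseMomentsOdd6 :
    Summit.QuantumFields.YangMills.Theses.BalabanLadder.UV →
      letI : MeasurableSpace (Matrix.specialUnitaryGroup (Fin 2) ℂ) := borel _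
      haveI : BorelSpace (Matrix.specialUnitaryGroup (Fin 2) ℂ) := ⟨rfl⟩
      ∃ (a : ℝ → ℝ) (c : ℝ) (C₁ B β₁ ℓ₁ P₀ : ℝ) (p : Fin 4 × Fin 4 → ℝ → ℝ), 0 < c ∧
      (∀ᶠ β in atTop, a β ≤ c * Transport.uRec β) ∧ 0 < ℓ₁ ∧ 0 < C₁ ∧ (∀ q β, |p q β| ≤ P₀) ∧
      ∀ β : ℝ, β₁ ≤ β → ∀ (L n : ℕ) (q : Fin n → Fin 4 × Fin 4) (x : Fin n → (Fin 4 → ℤ)) (R : ℕ),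
      (∀ i, (q i).1 < (q i).2) → 1 ≤ R → (R : ℝ) * a β ≤ ℓ₁ → 4 * R + 8 ≤ L →
      (∀ i j : Fin n, i ≠ j → ∃ k : Fin 4,
      (2 * (R : ℤ) + 4) ≤ |((((x i k - x j k : ℤ) : ZMod (2 * L + 1))).valMinAbs : ℤ)|) →
      ∀ T : Finset (Fin n),
      torusE (Matrix.specialUnitaryGroup (Fin 2) ℂ) (Literature.MathematicalPhysics.QuantumLattice.fundamentalLatticeRep 2) β L
      (fun U => Real.exp (∑ i ∈ T, (R : ℝ) ^ 4 / C₁ *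
      |kerE (Matrix.specialUnitaryGroup (Fin 2) ℂ) (Literature.MathematicalPhysics.QuantumLattice.fundamentalLatticeRep 2) β
      (fun k => x i k - (R + 1)) (2 * R + 3) U
      (plane (Matrix.specialUnitaryGroup (Fin 2) ℂ) (Literature.MathematicalPhysics.QuantumLattice.fundamentalLatticeRep 2) (q i) (x i)) -
      p (q i) β|)) ≤ Real.exp (B * T.card) :=
  fun _ => responseMomentsOdd6SU2_of_absMoments (absMoments_of_dominance stub_classicalDominance stub_classicalMoments)

/-- E0′ ceilings — a THEOREM of the skeleton (as v5(α)): (RM) through the landed press-button `TemperedResponse.stubCeilings_of_responseMoments`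
(p532738).  Statement = v4-F's `stub_ceilings` VERBATIM. -/
theorem stub_ceilings :
    Summit.QuantumFields.YangMills.Theses.BalabanLadder.UV →
      letI : MeasurableSpace (Matrix.specialUnitaryGroup (Fin 2) ℂ) := borel _
      haveI : BorelSpace (Matrix.specialUnitaryGroup (Fin 2) ℂ) := ⟨rfl⟩
      MomentBounds6 (Matrix.specialUnitaryGroup (Fin 2) ℂ) rF uRec :=
  fun hUV => Summit.QuantumFields.YangMills.Cruxes.UVSeamRec.TemperedResponse.stubCeilings_of_responseMoments
    (stub_responseMomentsOdd6 hUV)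

/-- STUB F-B∧F-C «compact-witness floors at an asymptotically-two-loop engine unit» (XL; NO `UV`; BYTE-IDENTICAL to v5(α)/v7c/v8c/v8d/coldwall_pure/extremal_coldwall/slack_coldwall; = the engine
data of the landed per-representation transfer `UnitTransfer.lowerBounds_uRec_of_engine rF`, p441552): the FUNDAMENTAL representation `rF` of `SU(2)` and
a unit map `a` with `a β / uRec β → c₀ > 0` carrying the `Q2`/`Q3` floors with COMPACTLY SUPPORTED witnesses.  Supplier: the NT line's conditional femto
package at `SU(2)`-fundamental (19353 `stub_cfp : CFP` engine E1–E3; landed discharge `FloorsEngineOfWindow.floorsEngine_of_fcp_commensurable rF a …`,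
p448741).  NOT rescued by this line (its rescue is a line on 19353).  Why it might fail: as NT (19353) — a β-uniform floor is dimensional transmutation
(barrier PerturbativeInvisibility) — plus the scaling of the non-perturbative unit (Patrascioiu–Seiler vs. consensus). -/
theorem stub_floorsEngine :
    letI : MeasurableSpace (Matrix.specialUnitaryGroup (Fin 2) ℂ) := borel _
    haveI : BorelSpace (Matrix.specialUnitaryGroup (Fin 2) ℂ) := ⟨rfl⟩
    ∃ (a : ℝ → ℝ) (c₀ : ℝ), 0 < c₀ ∧ (∀ β, 0 < a β) ∧
      Tendsto (fun β => a β / uRec β) atTop (𝓝 c₀) ∧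
      (∃ (v : 𝓢(EuclideanSpace ℝ (Fin 4), ℝ)) (ε β₅ Λ₅ : ℝ),
        HasCompactSupport (v : EuclideanSpace ℝ (Fin 4) → ℝ) ∧
        tsupport (v : EuclideanSpace ℝ (Fin 4) → ℝ) ⊆ {y : EuclideanSpace ℝ (Fin 4) | 0 < y 0} ∧ 0 < ε ∧
        ∀ β : ℝ, β₅ ≤ β → ∀ L : ℕ, Λ₅ ≤ a β * L →
          ε ≤ Q2 (Matrix.specialUnitaryGroup (Fin 2) ℂ) rF β L (a β) (thetaTest 4 v) v) ∧
      (∃ (f g h : 𝓢(EuclideanSpace ℝ (Fin 4), ℝ)) (ε β₅ Λ₅ : ℝ),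
        HasCompactSupport (f : EuclideanSpace ℝ (Fin 4) → ℝ) ∧
        HasCompactSupport (g : EuclideanSpace ℝ (Fin 4) → ℝ) ∧
        HasCompactSupport (h : EuclideanSpace ℝ (Fin 4) → ℝ) ∧
        Disjoint (tsupport (f : EuclideanSpace ℝ (Fin 4) → ℝ)) (tsupport (g : EuclideanSpace ℝ (Fin 4) → ℝ)) ∧
        Disjoint (tsupport (g : EuclideanSpace ℝ (Fin 4) → ℝ)) (tsupport (h : EuclideanSpace ℝ (Fin 4) → ℝ)) ∧
        Disjoint (tsupport (f : EuclideanSpace ℝ (Fin 4) → ℝ)) (tsupport (h : EuclideanSpace ℝ (Fin 4) → ℝ)) ∧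
        0 < ε ∧ ∀ β : ℝ, β₅ ≤ β → ∀ L : ℕ, Λ₅ ≤ a β * L →
          ε ≤ |Q3 (Matrix.specialUnitaryGroup (Fin 2) ℂ) rF β L (a β) f g h|) := by
  sorry

/-- COMPOSITION (kernel-checked, closed form): ceilings ⊕ engine floors ⊕ LANDED unit transfer ⊕ transport ⇒ the item BY NAME. -/
theorem UVSeamRec_of : Summit.QuantumFields.YangMills.Theses.BalabanLadder.UVSeamRec := by
  intro hUV G _ _ _ _ hG hcl
  letI : MeasurableSpace (Matrix.specialUnitaryGroup (Fin 2) ℂ) := borel _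
  haveI : BorelSpace (Matrix.specialUnitaryGroup (Fin 2) ℂ) := ⟨rfl⟩
  have hc := stub_ceilings hUV
  obtain ⟨a, c₀, hc₀, ha, hau, h2, h3⟩ := stub_floorsEngine
  have hlb := Summit.QuantumFields.YangMills.Cruxes.UVSeamRec.UnitTransfer.lowerBounds_uRec_of_engine rF hc₀ ha hau hc h2 h3
  exact stub_transport ⟨rF, hlb, hc⟩ G hG hcl

end Summit.QuantumFields.YangMills.Cruxes.UVSeamRec.ClassicalDominance
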